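import Summits.QuantumFields.YangMills.Theses.LevelShiftBootstrap
import Summits.QuantumFields.YangMills.Theorems.LevelShiftBootstrapHistoryTailOfLocalStabilityInduction

/-!
# Route `LevelShiftBootstrap` (rung R3 of LADDER-YM), support item `HistoryTailOfLocalStability` (stmt-QuantumFields-26949): THE BOOTSTRAP GLUE,
# `LocalUnitStabilityL → (∀ L b₁ p₁, ∃ profile ≥ (b₁, p₁), ∀ m > 0, ∃ γ₁ > 0, ∀ F γ ≤ γ₁, HistoryTailAt F γ b₀ p₀ m)` — PROVED

Width seat `ym-line-sfw-p2-w3` g22 (home cell `ym-idea-1`; critic V67 PRICE (1) «glue first»), `--workitem stmt-QuantumFields-26949`.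

THE ARGUMENT.  Given `L` and thresholds `(b₁, p₁)`, take `(q, m̄, c, b₁', p₁')` from the crux `LocalUnitStabilityL` (stmt-QuantumFields-27016) at `L`;
choose the NATURAL exponent `P = ⌈max p₁ p₁'⌉ + q + 3` (so `P ≥ q + 2`, `P > 2`) and the crux profile `b = max b₁' (max (b₁/c) 1)`, and get the
crux's `γ₁ ≤ 1` and `R`.  The OUTPUT profile is `(c·b, P)` (`≥ (b₁, p₁)`): for every family `F` with `F.L = L` and every `0 < γ ≤ γ₁` the
level-shift bootstrap (parts 1–5, `HistoryTailOfLocalStability.perPlaquette_tail_of_crossRatio`, fed with the crux's clause for every refinement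
`F.refine h` at `γL^{-h} ≤ γ₁`) gives a Gaussian per-plaquette large-field tail at profile `c·b` at every height, uniformly in the run, whence
`HistoryTailAt F γ (c b) P m` for EVERY `m > 0` by the landed bookkeeping `CutoffNotchTransport.historyTailAt_of_perPlaquette_rated` (loss rate
`R = 1`).  `§1 perPlaquette_tail_of_localUnitStabilityL` is the reusable form (also consumed by crux r3 of route `SmallFieldWidening`).

HONEST FRAMING.  This closes the route's support item ONLY; the crux `LocalUnitStabilityL` (volume-uniform local cross-cut-off stability of one
unit-plaquette event, XL) and the parent route's residual cruxes stay OPEN; rung R3 (`YM3TorusSU2`) is a RECORD rung — no summit, no Clay claim;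
the Yang–Mills mass gap is NOT proved by any of this.  No `def`, no `sorry`.

References: C. King, CMP **102** (1986) 649–677 [King1986] (Thm 3.4 (3.9)–(3.13) p.656, (3.12) p.657); T. Bałaban, CMP **102** (1985) 255–275
[Balaban1985UV3] ((7) p.257, (71) p.273); J. Fröhlich, R. Israel, E. Lieb, B. Simon, CMP **62** (1978) 1–34 [FrohlichIsraelLiebSimon1978].
-/

set_option autoImplicit false

noncomputable section

open MeasureTheory
open scoped BigOperators
open Literature.MathematicalPhysics.QuantumFieldTheory
open Literature.MathematicalPhysics.QuantumFieldTheory.Balaban1983to89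
open Literature.MathematicalPhysics.QuantumFieldTheory.Balaban1983to89.T3ContinuumYM3Torus
open Literature.MathematicalPhysics.QuantumFieldTheory.Balaban1983to89.T3UnitScaleTilt
open Literature.MathematicalPhysics.QuantumFieldTheory.Balaban1983to89.T3UnitLawDensityEML
open Literature.MathematicalPhysics.QuantumFieldTheory.Balaban1983to89.T3InteriorExcision

namespace Summit.QuantumFields.YangMills.Theorems.HistoryTailOfLocalStability

/-! ## §1 The crux, unpacked: a Gaussian per-plaquette tail for every family, above any thresholds -/

/-- Bałaban's profile is non-negative at couplings `≤ 1`: `0 ≤ p(√γ)` (`0 < γ ≤ 1`, `0 ≤ b₀`, natural exponent). [cite: Balaban1985UV3, (7) p.257] -/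
theorem pFun_sqrt_nonneg {γ b₀ : ℝ} (hγ : 0 < γ) (hγ1 : γ ≤ 1) (hb₀ : 0 ≤ b₀) (P : ℕ) :
    0 ≤ B10.pFun b₀ (P : ℝ) (Real.sqrt γ) := by
  unfold B10.pFun
  rw [Real.rpow_natCast]
  have h1 : Real.sqrt γ ≤ 1 := Real.sqrt_le_one.mpr hγ1
  have h2 : 0 < Real.sqrt γ := Real.sqrt_pos.mpr hγ
  have h3 : 0 ≤ Real.log (Real.sqrt γ)⁻¹ := Real.log_nonneg ((one_le_inv₀ h2).mpr h1)
  positivity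

/-- **THE CRUX UNPACKED THROUGH THE BOOTSTRAP**: under `LocalUnitStabilityL`, for every block size `L` and thresholds `(b₁, p₁)` there are a
profile `(b₀, P)` above them (`P` natural, `P > 2`) and `0 < γ₁ ≤ 1` such that every family `F` with `F.L = L` at every `0 < γ ≤ γ₁` has a Gaussian
per-plaquette large-field tail at profile `b₀` at EVERY height, uniformly in the run (constants depending on `F, γ`).
[cite: King1986, Thm 3.4 (3.9)-(3.13) p.656; Balaban1985UV3, (7) p.257 and (71) p.273] -/
theorem perPlaquette_tail_of_localUnitStabilityL
    (hS : Summit.QuantumFields.YangMills.Theses.LevelShiftBootstrap.LocalUnitStabilityL) (L : ℕ) (b₁ p₁ : ℝ) :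
    ∃ (b₀ : ℝ) (P : ℕ) (γ₁ : ℝ), b₁ ≤ b₀ ∧ p₁ ≤ (P : ℝ) ∧ 0 < b₀ ∧ 2 < (P : ℝ) ∧ 0 < γ₁ ∧ γ₁ ≤ 1 ∧
      ∀ (F : T3Family) (γ : ℝ), F.L = L → 0 < γ → γ ≤ γ₁ →
        ∃ (C : ℝ) (A : ℕ) (a : ℝ), 0 ≤ C ∧ 0 < a ∧ ∀ (K j : ℕ), j ≤ K → ∀ qq : Plaq (F.P K) j,
          (gibbsK F ℰp γ K).real
              {U | θBal F.L γ b₀ (P : ℝ) (K - j) ≤ GaugeGroup.dist1 (GaugeField.plaqHol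
                (Averaging.iter (fun i => BlockAveraging.blockAvg (P := F.P K) (j := i) ℰp) j U) qq)} ≤
            C * (γ * ((F.L : ℝ)⁻¹) ^ (K - j))⁻¹ ^ A *
              Real.exp (-(a * B10.pFun b₀ (P : ℝ) (Real.sqrt (γ * ((F.L : ℝ)⁻¹) ^ (K - j))) ^ 2)) := by
  obtain ⟨q, mbar, c, b₁', p₁', hm, hc, hc1, H⟩ := hS L
  -- the profile: a natural exponent above both thresholds and `q + 2`; a crux constant above `b₁'`, `b₁/c` and `1`
  obtain ⟨P, hPdef⟩ : ∃ P : ℕ, P = ⌈max p₁ p₁'⌉₊ + q + 3 := ⟨_, rfl⟩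
  obtain ⟨bc, hbcdef⟩ : ∃ bc : ℝ, bc = max b₁' (max (b₁ / c) 1) := ⟨_, rfl⟩
  have hPceil : max p₁ p₁' ≤ ((⌈max p₁ p₁'⌉₊ : ℕ) : ℝ) := Nat.le_ceil _
  have hPcast : (P : ℝ) = ((⌈max p₁ p₁'⌉₊ : ℕ) : ℝ) + q + 3 := by rw [hPdef]; push_cast; ring
  have hq0 : (0 : ℝ) ≤ q := Nat.cast_nonneg q
  have hp₁ : p₁ ≤ (P : ℝ) := by rw [hPcast]; linarith [le_max_left p₁ p₁']
  have hp₁' : p₁' ≤ (P : ℝ) := by rw [hPcast]; linarith [le_max_right p₁ p₁']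
  have hP2 : 2 < (P : ℝ) := by
    rw [hPcast]
    have : (0 : ℝ) ≤ ((⌈max p₁ p₁'⌉₊ : ℕ) : ℝ) := Nat.cast_nonneg _
    linarith
  have hPq : q + 2 ≤ P := by rw [hPdef]; omega
  have hbc1 : 1 ≤ bc := by rw [hbcdef]; exact le_trans (le_max_right _ _) (le_max_right _ _)
  have hbc0 : 0 < bc := lt_of_lt_of_le one_pos hbc1
  have hbcb₁' : b₁' ≤ bc := by rw [hbcdef]; exact le_max_left _ _
  have hbcb₁ : b₁ ≤ c * bc := by
    have : b₁ / c ≤ bc := by rw [hbcdef]; exact le_trans (le_max_left _ _) (le_max_right _ _)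
    have := mul_le_mul_of_nonneg_left this hc.le
    rwa [mul_div_cancel₀ _ hc.ne'] at this
  obtain ⟨γ₁, R, hγ₁, hγ₁1, HH⟩ := H bc (P : ℝ) hbcb₁' hp₁' hbc0 hP2
  refine ⟨c * bc, P, γ₁, hbcb₁, hp₁, mul_pos hc hbc0, hP2, hγ₁, hγ₁1, fun F γ hFL hγ hγle => ?_⟩
  subst hFL
  -- the crux's clause for every family of block size `F.L`, with the slack constant made non-negative
  refine perPlaquette_tail_of_crossRatio F hγ (hγle.trans hγ₁1) hγ₁ (le_max_right R 0) hbc0 hc hc1 hm hPq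
    fun F' γ' hF'L hγ' hγ'le => ?_
  obtain ⟨ρ, τ, hρ0, hτ, hρsum, hstep⟩ := HH F' γ' hF'L hγ' hγ'le
  refine ⟨ρ, τ, hρ0, hτ, fun N => (hρsum N).trans ?_, hstep⟩
  have hX : 0 ≤ B10.pFun bc (P : ℝ) (Real.sqrt γ') * ((F'.m : ℝ) + 1) ^ q :=
    mul_nonneg (pFun_sqrt_nonneg hγ' (hγ'le.trans hγ₁1) hbc0.le P) (by positivity)
  calc R * B10.pFun bc (P : ℝ) (Real.sqrt γ') * ((F'.m : ℝ) + 1) ^ q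
      = R * (B10.pFun bc (P : ℝ) (Real.sqrt γ') * ((F'.m : ℝ) + 1) ^ q) := by ring
    _ ≤ max R 0 * (B10.pFun bc (P : ℝ) (Real.sqrt γ') * ((F'.m : ℝ) + 1) ^ q) :=
        mul_le_mul_of_nonneg_right (le_max_left R 0) hX
    _ = max R 0 * B10.pFun bc (P : ℝ) (Real.sqrt γ') * ((F'.m : ℝ) + 1) ^ q := by ring

/-! ## §2 The support item -/

/-- **`HistoryTailOfLocalStability` HOLDS** (item stmt-QuantumFields-26949 of route `LevelShiftBootstrap`): the level-shift bootstrap turns the local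
unit-event stability along the cut-off into K2's body `HistoryTailAt F γ b₀ p₀ m` for EVERY `m > 0`, at a profile above any prescribed
thresholds.  [cite: King1986, Thm 3.4 (3.9)-(3.13) p.656 and (3.12) p.657; Balaban1985UV3, (7) p.257 and (71) p.273] -/
theorem levelShiftBootstrap_historyTailOfLocalStability_proof :
    Summit.QuantumFields.YangMills.Theses.LevelShiftBootstrap.HistoryTailOfLocalStability := by
  intro hS L b₁ p₁
  obtain ⟨b₀, P, γ₁, hb₁, hp₁, hb₀, hP2, hγ₁, hγ₁1, H⟩ := perPlaquette_tail_of_localUnitStabilityL hS L b₁ p₁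
  refine ⟨b₀, (P : ℝ), hb₁, hp₁, hb₀, hP2, fun m hm => ⟨γ₁, hγ₁, fun F γ hFL hγ hγle => ?_⟩⟩
  obtain ⟨C, A, a, hC, ha, hfin⟩ := H F γ hFL hγ hγle
  refine CutoffNotchTransport.historyTailAt_of_perPlaquette_rated F hγ (hγle.trans hγ₁1) hb₀ (by linarith) hm
    (C := C) (R := 1) (c := a) (A := A) hC le_rfl ha fun K j hjK p => ?_
  rw [one_pow, mul_one]
  exact hfin K j hjK p

end Summit.QuantumFields.YangMills.Theorems.HistoryTailOfLocalStability

end
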